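import Mathlib
import Summits.AtomisticToContinuum.Crystallization.Theorems.PhononSlackCertificatesNearFieldConvexityRoughOfCertificate
import Summits.AtomisticToContinuum.Crystallization.Theorems.PhononSlackCertificatesNearFieldConvexityRoughOfDistortion

/-!
# Crux `NashClassCertificates.NashNearField` (stmt-AtomisticToContinuum-16827), line `birth`:
pieces of stub `stub_nashRoughSitesPaid` (II_band on the Nash class) — the two reductions, NASH-THREADED

The registered stub `stub_nashRoughSitesPaid` is the twin crux's (13958) `stub_roughSitesPaid` (II_band: on a set
`Ω` of `1/20`-good particles the particles that are not even `ε₁`-good are paid linearly,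
`#{i ∈ Ω : ¬ ε₁-good} ≤ K·[E_self(Ω) − |Ω|·e*] + C·#∂₄Ω`) specialised to `δ = 1/3` and weakened by two extra
hypotheses on the configuration: the Nash clause (no particle lowers its site energy by relocating) and exact
force balance.  The twin's two landed reductions (`stub_roughOfCertificate`: II_band from a POINTWISE rough-site
certificate with `r⁻⁶` transfers; `stub_roughOfDistortion`: II_band from the SUMMED squared goodness threshold,
by Chebyshev) quantify their hypothesis over ALL `δ`-separated configurations, so they cannot consume a certificate
that is only known on the Nash class.  This file threads the Nash lever through both:

* `roughCount_le_of_certificate` — the bookkeeping of `stub_roughOfCertificate` made PER CONFIGURATION and for an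
  ARBITRARY predicate `P` in place of "not `ε₁`-good": for `δ > 0`, a gap `g > 0` and an envelope constant `M`
  there are `K = 1/g ≥ 0` and `C = C(δ, g, M)` such that for every `δ`-separated `x`, every set `Ω` of `1/20`-good
  particles and every antisymmetric `τ` with `|τ i j| ≤ M·|x i − x j|⁻⁶` whose calibrated self-site excess
  `(½Σ_{j∈Ω∖i} V − e*) + Σ_{j∈Ω} τ i j` is `≥ 0` at the radius-8 interior sites and `≥ g` at those satisfying `P`,
  `#{i ∈ Ω : P i} ≤ K·[E_self(Ω) − |Ω|·e*] + C·#∂₄Ω`.  (Antisymmetry cancellation `lc_bookkeeping`, flux into the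
  collar by `stub_fluxEnvelope`, collar floor `stub_selfSiteFloor`, collar count `collar8_card_le` +
  `stub_pairCountOfCrossing`; adapted from the twin's proof.)
* `stub_nashRoughOfCertificate` — hence: a pointwise rough-site certificate that is only required for
  `1/3`-separated NASH, FORCE-BALANCED configurations implies `stub_nashRoughSitesPaid` VERBATIM.
* `stub_nashRoughOfDistortion` — likewise the Chebyshev reduction: the summed bound
  `Σ_{i∈Ω} d(i)² ≤ K·[E_self(Ω) − |Ω|·e*] + C·#∂₄Ω` (`d(i) = sInf {e ≥ 0 : i is e-good}`), required only on the
  Nash class at `δ = 1/3`, implies `stub_nashRoughSitesPaid` verbatim (`sq_mul_natCard_notGood_le`).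

Numerical status of the certificate itself (worker audit, kit jobs j027690 / j027693 / j027726 / j027729 / j028012;
`ROUGH_STATUS.md` on the item): no falsifier was found.  The cheapest all-good rough configurations priced are PLANAR and AFFINE: an
unrelaxed registry offset of `0.0138a` across one close-packed gap roughens the two adjacent layers at `1.83·10⁻⁴` per rough site,
and uniformly sheared fcc / hcp at the `1/100` goodness threshold cost `2.46·10⁻⁴` (fcc, tetragonal `C′` shear, measured from `e*`)
resp. `3.03·10⁻⁴` (hcp, basal shear) per site — so `K ≥ 5.5·10³` is necessary at `ε₁ = 1/100`; localised rough sites are dearer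
per rough site (`≥ 4.2·10⁻⁴`, harmonic response of a clamped two-shell cluster), isotropic mis-scaling costs `≥ 2.7·10⁻²`, and
random small-cell tube states all relax back to fcc / hcp.  The one-centre bound is NEGATIVE: the minimum over the `1/20` tube of
the calibrated two-shell half-sum with the optimal-lattice tail lies `0.046` below `e*`, linearly in the tolerance — the half-bond
site excess has a nonvanishing first variation under shell displacements, so a certificate must cancel it exactly (the virial
transfer below, which uses force balance of the reference lattice) and then certify a quadratic gap two orders of magnitude smaller
than the transfers: the crux-sized non-perturbative residue.  All `[folklore]`.
-/

noncomputable section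

open scoped BigOperators
open Literature.MathematicalPhysics.StatisticalMechanics Literature.Geometry.DiscreteGeometry

namespace Summit.AtomisticToContinuum.Crystallization.Theorems.NashClassCertificatesNashNearField

open Summit.AtomisticToContinuum.Crystallization.Theorems.PhononSlackNearFieldConvexity

/-- **Per-configuration bookkeeping of a pointwise rough-site certificate, arbitrary predicate.**  For `δ > 0`,
`g > 0` and `M` there are `K ≥ 0` (namely `1/g`) and `C` such that: for every `δ`-separated configuration, every
finite set `Ω` of `1/20`-good particles, every predicate `P` and every antisymmetric transfer `τ` with
`|τ i j| ≤ M·|x i − x j|⁻⁶` making the calibrated self-site excess nonnegative at the radius-8 interior sites of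
`Ω` and `≥ g` at those satisfying `P`, one has `#{i ∈ Ω : P i} ≤ K·[E_self(Ω) − |Ω|·e*] + C·#∂₄Ω`.
Adapted from the twin's `stub_roughOfCertificate` (antisymmetry cancellation on the interior, flux envelope into
the collar, collar floor, collar count). [folklore] -/
theorem roughCount_le_of_certificate (δ : ℝ) (hδ : 0 < δ) (g : ℝ) (hg : 0 < g) (M : ℝ) :
    ∃ K : ℝ, 0 ≤ K ∧ ∃ C : ℝ, ∀ (N : ℕ) (x : Fin N → EuclideanSpace ℝ (Fin 3)),
      (∀ i j : Fin N, i ≠ j → δ ≤ dist (x i) (x j)) →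
      ∀ Ω : Finset (Fin N), (∀ i ∈ Ω, IsTwoShellGood (1 / 20) (47 / 50) 1 x i) →
      ∀ (P : Fin N → Prop) (τ : Fin N → Fin N → ℝ), (∀ i j, τ i j = -τ j i) →
      (∀ i j, |τ i j| ≤ M * (dist (x i) (x j))⁻¹ ^ 6) →
      (∀ i ∈ Ω, (∀ k : Fin N, dist (x k) (x i) ≤ 8 → k ∈ Ω) →
        0 ≤ ((1 / 2 : ℝ) * (∑ j ∈ Ω.erase i, lennardJones (dist (x i) (x j))) -
            (⨅ Q : PeriodicConfiguration 3, Q.energyPerParticle lennardJones)) + ∑ j ∈ Ω, τ i j ∧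
        (P i → g ≤ ((1 / 2 : ℝ) * (∑ j ∈ Ω.erase i, lennardJones (dist (x i) (x j))) -
            (⨅ Q : PeriodicConfiguration 3, Q.energyPerParticle lennardJones)) + ∑ j ∈ Ω, τ i j)) →
      (Nat.card {i : Fin N // i ∈ Ω ∧ P i} : ℝ) ≤
        K * ((∑ i ∈ Ω, (1 / 2 : ℝ) * (∑ j ∈ Ω.erase i, lennardJones (dist (x i) (x j)))) -
          (Ω.card : ℝ) * (⨅ Q : PeriodicConfiguration 3, Q.energyPerParticle lennardJones)) +
        C * (Nat.card {i : Fin N // i ∈ Ω ∧ ∃ j : Fin N, j ∉ Ω ∧ dist (x j) (x i) ≤ 4} : ℝ) := by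
  -- adapted from `PhononSlackNearFieldConvexity.stub_roughOfCertificate` (twin crux 13958, worker W3)
  obtain ⟨Cp, hCp⟩ := stub_pairCountOfCrossing δ hδ
  set Kc : ℝ := 1 + |Cp| * (17 / 4 : ℝ) ^ 4 with hKcdef
  set L : ℝ := g + 250 / 12 * δ⁻¹ ^ 6 + 250 * |M| * δ⁻¹ ^ 6 with hLdef
  refine ⟨1 / g, by positivity, L * Kc / g, ?_⟩
  intro N x hsep Ω hΩ P τ hτ hτM hpt
  classical
  -- radius-8 interior and collar of `Ω`
  set I : Finset (Fin N) := Ω.filter (fun i => ∀ k : Fin N, dist (x k) (x i) ≤ 8 → k ∈ Ω) with hIdef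
  set B : Finset (Fin N) := Ω.filter (fun i => ∃ j : Fin N, j ∉ Ω ∧ dist (x j) (x i) ≤ 8) with hBdef
  rw [lc_natCard_eq, lc_natCard_eq]
  have hIΩ : I ⊆ Ω := Finset.filter_subset _ _
  have hBmem : ∀ i, i ∈ B ↔ i ∈ Ω ∧ i ∉ I := by
    intro i
    simp only [hBdef, hIdef, Finset.mem_filter]
    constructor
    · rintro ⟨hi, j, hj, hd⟩
      exact ⟨hi, fun h' => hj (h'.2 j hd)⟩
    · rintro ⟨hi, h'⟩
      refine ⟨hi, ?_⟩
      by_contra hne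
      exact h' ⟨hi, fun j hd => by_contra fun hj => hne ⟨j, hj, hd⟩⟩
  have hdisj : Disjoint I B := by
    rw [Finset.disjoint_left]
    intro i hiI hiB
    exact ((hBmem i).1 hiB).2 hiI
  -- the flux into the collar, by the envelope
  have hfluxIB : ∑ i ∈ I, ∑ j ∈ B, τ i j ≤ 250 * |M| * δ⁻¹ ^ 6 * (B.card : ℝ) := by
    have h1 : ∑ i ∈ I, ∑ j ∈ B, τ i j ≤ ∑ i ∈ I, ∑ j ∈ B, |M| * (dist (x i) (x j))⁻¹ ^ 6 := by
      refine Finset.sum_le_sum fun i _ => Finset.sum_le_sum fun j _ => ?_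
      have hb := hτM i j
      have h0 : (0 : ℝ) ≤ (dist (x i) (x j))⁻¹ ^ 6 := by positivity
      calc τ i j ≤ |τ i j| := le_abs_self _
        _ ≤ M * (dist (x i) (x j))⁻¹ ^ 6 := hb
        _ ≤ |M| * (dist (x i) (x j))⁻¹ ^ 6 := mul_le_mul_of_nonneg_right (le_abs_self M) h0
    have h2 : ∑ i ∈ I, ∑ j ∈ B, |M| * (dist (x i) (x j))⁻¹ ^ 6 =
        |M| * ∑ i ∈ I, ∑ j ∈ B, (dist (x i) (x j))⁻¹ ^ 6 := by
      rw [Finset.mul_sum]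
      refine Finset.sum_congr rfl fun i _ => ?_
      rw [Finset.mul_sum]
    have h3 := stub_fluxEnvelope N x δ hδ hsep I B hdisj
    have hM0 : 0 ≤ |M| := abs_nonneg M
    rw [h2] at h1
    nlinarith [h1, h3, hM0]
  -- the abstract bookkeeping (radius-8 interior), predicate `P`
  have key := lc_bookkeeping P
    (fun i : Fin N => (1 / 2 : ℝ) * (∑ j ∈ Ω.erase i, lennardJones (dist (x i) (x j))) -
      (⨅ Q : PeriodicConfiguration 3, Q.energyPerParticle lennardJones))
    τ Ω I B hg hτ hIΩ hBmem
    (fun i hi => hpt i (hIΩ hi) (Finset.mem_filter.1 hi).2)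
    hfluxIB
    (fun i _ => stub_selfSiteFloor N x δ hδ hsep Ω i)
  beta_reduce at key
  -- the collar count: `#B ≤ Kc · #∂₄Ω`
  have hcol := collar8_card_le x Ω
  have hpair := hCp N x hsep Ω hΩ (17 / 4) (by norm_num)
  rw [lc_natCard_eq] at hpair
  set B4c : ℝ := ((Ω.filter fun i => ∃ j : Fin N, j ∉ Ω ∧ dist (x j) (x i) ≤ 4).card : ℝ) with hB4c
  have hB40 : 0 ≤ B4c := Nat.cast_nonneg _
  have hBle : (B.card : ℝ) ≤ Kc * B4c := by
    have h1 : (B.card : ℝ) ≤ B4c + Cp * (17 / 4 : ℝ) ^ 4 * B4c := by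
      have := hcol
      rw [← hBdef] at this
      linarith
    have h2 : Cp * (17 / 4 : ℝ) ^ 4 * B4c ≤ |Cp| * (17 / 4 : ℝ) ^ 4 * B4c :=
      mul_le_mul_of_nonneg_right (mul_le_mul_of_nonneg_right (le_abs_self Cp) (by positivity)) hB40
    rw [hKcdef]
    nlinarith
  have hRHS : (∑ i ∈ Ω, (1 / 2 : ℝ) * (∑ j ∈ Ω.erase i, lennardJones (dist (x i) (x j)))) -
      (Ω.card : ℝ) * (⨅ Q : PeriodicConfiguration 3, Q.energyPerParticle lennardJones) =
      ∑ i ∈ Ω, ((1 / 2 : ℝ) * (∑ j ∈ Ω.erase i, lennardJones (dist (x i) (x j))) -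
        (⨅ Q : PeriodicConfiguration 3, Q.energyPerParticle lennardJones)) := by
    rw [Finset.sum_sub_distrib, Finset.sum_const, nsmul_eq_mul]
  rw [hRHS]
  set S : ℝ := ∑ i ∈ Ω, ((1 / 2 : ℝ) * (∑ j ∈ Ω.erase i, lennardJones (dist (x i) (x j))) -
    (⨅ Q : PeriodicConfiguration 3, Q.energyPerParticle lennardJones)) with hSdef
  set nb : ℝ := ((Ω.filter fun i : Fin N => P i).card : ℝ) with hnbdef
  have hB0 : (0 : ℝ) ≤ (B.card : ℝ) := Nat.cast_nonneg _
  have hL0 : 0 ≤ L := by rw [hLdef]; positivity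
  have hstep : L * (B.card : ℝ) ≤ L * (Kc * B4c) := mul_le_mul_of_nonneg_left hBle hL0
  have hfin : g * nb ≤ S + L * (Kc * B4c) := by
    rw [hLdef] at hstep ⊢
    nlinarith [key, hstep, hB0]
  have hdiv : nb = g * nb / g := by
    field_simp
  calc nb = g * nb / g := hdiv
    _ ≤ (S + L * (Kc * B4c)) / g := div_le_div_of_nonneg_right hfin hg.le
    _ = 1 / g * S + L * Kc / g * B4c := by ring

/-- **Registered-shape headline `stub_nashRoughOfCertificate`: `stub_nashRoughSitesPaid` from a pointwise rough-site
certificate on the NASH CLASS.**  If for every `ε₁ ∈ [1/100, 1/20]` there are a gap `g > 0` and an envelope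
constant `M` such that every `1/3`-separated configuration satisfying the Nash clause and exact force balance,
and every set `Ω` of its `1/20`-good particles (with `2/5`-charts at the radius-3 interior sites), carry an
antisymmetric transfer `τ`, `|τ i j| ≤ M·|x i − x j|⁻⁶`, with calibrated self-site excess `≥ 0` at the radius-8
interior sites and `≥ g` at the non-`ε₁`-good ones, then the registered statement of `stub_nashRoughSitesPaid`
holds verbatim (`roughCount_le_of_certificate` at `δ = 1/3`, predicate "not `ε₁`-good"). [folklore] -/
theorem stub_nashRoughOfCertificate
    (hcert : ∀ ε₁ : ℝ, 1 / 100 ≤ ε₁ → ε₁ ≤ 1 / 20 → ∃ g : ℝ, 0 < g ∧ ∃ M : ℝ, ∀ (N : ℕ) (x : Fin N → EuclideanSpace ℝ (Fin 3)), (∀ i j : Fin N, i ≠ j → 1 / 3 ≤ dist (x i) (x j)) → (∀ (i : Fin N) (y : EuclideanSpace ℝ (Fin 3)), (∀ j : Fin N, j ≠ i → y ≠ x j) → siteEnergy lennardJones x i ≤ ∑ j ∈ Finset.univ.erase i, lennardJones (dist y (x j))) → (∀ i : Fin N, ∑ j ∈ Finset.univ.erase i, (deriv lennardJones (dist (x i)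 (x j)) / dist (x i) (x j)) • (x i - x j) = 0) → ∀ Ω : Finset (Fin N), (∀ i ∈ Ω, IsTwoShellGood (1 / 20) (47 / 50) 1 x i) → (∀ i ∈ Ω, (∀ k : Fin N, dist (x k) (x i) ≤ 3 → k ∈ Ω) → (∃ (A : EuclideanSpace ℝ (Fin 3) →ₗᵢ[ℝ] EuclideanSpace ℝ (Fin 3)) (a h : ℝ) (s : ℤ → ℤ), 47 / 50 ≤ a ∧ a ≤ 1 ∧ 39 / 50 * a ≤ h ∧ h ≤ 17 / 20 * a ∧ IsHaggSeq s ∧ (fun S : Set (EuclideanSpace ℝ (Fin 3)) => (∀ j : Fin N, dist (x j) (x i) ≤ 2 → ∃ p ∈ S, dist (x j) p ≤ 2 / 5) ∧ (∀ p ∈ S, dist p (x i) ≤ 2 → ∃ j : Fin N, dist (x j) p ≤ 2 / 5)) {p | ∃ m u v : ℤ, p = x i + A (((u : ℝ) • triangularVec₁ a) + ((v : ℝ) • triangularVec₂ a) + ((haggLabel s m : ℝ) • barlowOffset a) + ((m : ℝ) • layerNormal h))})) → ∃ τ : Fin N → Fin N → ℝ, (∀ i j, τ i j = -τ j i) ∧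 (∀ i j, |τ i j| ≤ M * (dist (x i) (x j))⁻¹ ^ 6) ∧ ∀ i ∈ Ω, (∀ k : Fin N, dist (x k) (x i) ≤ 8 → k ∈ Ω) → 0 ≤ ((1 / 2 : ℝ) * (∑ j ∈ Ω.erase i, lennardJones (dist (x i) (x j))) - (⨅ Q : PeriodicConfiguration 3, Q.energyPerParticle lennardJones)) + ∑ j ∈ Ω, τ i j ∧ (¬ IsTwoShellGood ε₁ (47 / 50) 1 x i → g ≤ ((1 / 2 : ℝ) * (∑ j ∈ Ω.erase i, lennardJones (dist (x i) (x j))) - (⨅ Q : PeriodicConfiguration 3, Q.energyPerParticle lennardJones)) + ∑ j ∈ Ω, τ i j)) :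
    ∀ ε₁ : ℝ, 1 / 100 ≤ ε₁ → ε₁ ≤ 1 / 20 → ∃ K : ℝ, 0 ≤ K ∧ ∃ C : ℝ, ∀ (N : ℕ) (x : Fin N → EuclideanSpace ℝ (Fin 3)),
      (∀ i j : Fin N, i ≠ j → 1 / 3 ≤ dist (x i) (x j)) →
      (∀ (i : Fin N) (y : EuclideanSpace ℝ (Fin 3)), (∀ j : Fin N, j ≠ i → y ≠ x j) → siteEnergy lennardJones x i ≤ ∑ j ∈ Finset.univ.erase i, lennardJones (dist y (x j))) →
      (∀ i : Fin N, ∑ j ∈ Finset.univ.erase i, (deriv lennardJones (dist (x i) (x j)) / dist (x i) (x j)) • (x i - x j) = 0) →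
      ∀ Ω : Finset (Fin N), (∀ i ∈ Ω, IsTwoShellGood (1 / 20) (47 / 50) 1 x i) →
      (∀ i ∈ Ω, (∀ k : Fin N, dist (x k) (x i) ≤ 3 → k ∈ Ω) → (∃ (A : EuclideanSpace ℝ (Fin 3) →ₗᵢ[ℝ] EuclideanSpace ℝ (Fin 3)) (a h : ℝ) (s : ℤ → ℤ), 47 / 50 ≤ a ∧ a ≤ 1 ∧ 39 / 50 * a ≤ h ∧ h ≤ 17 / 20 * a ∧ IsHaggSeq s ∧ (fun S : Set (EuclideanSpace ℝ (Fin 3)) => (∀ j : Fin N, dist (x j) (x i) ≤ 2 → ∃ p ∈ S, dist (x j) p ≤ 2 / 5) ∧ (∀ p ∈ S, dist p (x i) ≤ 2 → ∃ j : Fin N, dist (x j) p ≤ 2 / 5)) {p | ∃ m u v : ℤ, p = x i + A (((u : ℝ) • triangularVec₁ a) + ((v : ℝ) • triangularVec₂ a) + ((haggLabel s m : ℝ) • barlowOffset a) + ((m : ℝ) • layerNormal h))})) → (Nat.card {i : Fin N // i ∈ Ω ∧ ¬ IsTwoShellGood ε₁ (47 / 50) 1 x i} : ℝ) ≤ K *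 ((∑ i ∈ Ω, (1 / 2 : ℝ) * (∑ j ∈ Ω.erase i, lennardJones (dist (x i) (x j)))) - (Ω.card : ℝ) * (⨅ Q : PeriodicConfiguration 3, Q.energyPerParticle lennardJones)) + C * (Nat.card {i : Fin N // i ∈ Ω ∧ ∃ j : Fin N, j ∉ Ω ∧ dist (x j) (x i) ≤ 4} : ℝ) := by
  intro ε₁ h1 h2
  obtain ⟨g, hg, M, hM⟩ := hcert ε₁ h1 h2
  obtain ⟨K, hK, C, hKC⟩ := roughCount_le_of_certificate (1 / 3) (by norm_num) g hg M
  refine ⟨K, hK, C, fun N x hsep hnash hfb Ω hΩ hch => ?_⟩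
  obtain ⟨τ, hτ, hτM, hpt⟩ := hM N x hsep hnash hfb Ω hΩ hch
  exact hKC N x hsep Ω hΩ (fun i => ¬ IsTwoShellGood ε₁ (47 / 50) 1 x i) τ hτ hτM hpt

/-- **Registered-shape headline `stub_nashRoughOfDistortion`: `stub_nashRoughSitesPaid` from the summed squared
goodness threshold on the NASH CLASS (Chebyshev).**  If `Σ_{i∈Ω} d(i)² ≤ K·[E_self(Ω) − |Ω|·e*] + C·#∂₄Ω`
(`d(i) = sInf {e : ℝ | 0 ≤ e ∧ IsTwoShellGood e (47/50) 1 x i}`) holds for every `1/3`-separated configuration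
satisfying the Nash clause and exact force balance and every set `Ω` of its `1/20`-good particles carrying
`2/5`-charts at the radius-3 interior sites, then the registered statement of `stub_nashRoughSitesPaid` holds
verbatim with constants `K/ε₁²`, `C/ε₁²` (`sq_mul_natCard_notGood_le`). [folklore] -/
theorem stub_nashRoughOfDistortion
    (hsq : ∃ K : ℝ, 0 ≤ K ∧ ∃ C : ℝ, ∀ (N : ℕ) (x : Fin N → EuclideanSpace ℝ (Fin 3)), (∀ i j : Fin N, i ≠ j → 1 / 3 ≤ dist (x i) (x j)) → (∀ (i : Fin N) (y : EuclideanSpace ℝ (Fin 3)), (∀ j : Fin N, j ≠ i → y ≠ x j) → siteEnergy lennardJones x i ≤ ∑ j ∈ Finset.univ.erase i, lennardJones (dist y (x j))) → (∀ i : Fin N, ∑ j ∈ Finset.univ.erase i, (deriv lennardJones (dist (x i) (x j)) / dist (x i) (x j)) • (x i - x j) = 0) → ∀ Ω : Finset (Fin N), (∀ i ∈ Ω, IsTwoShellGood (1 / 20) (47 / 50) 1 x i) → (∀ i ∈ Ω, (∀ k : Fin N, dist (x k) (x i) ≤ 3 → k ∈ Ω) → (∃ (A : EuclideanSpace ℝ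 (Fin 3) →ₗᵢ[ℝ] EuclideanSpace ℝ (Fin 3)) (a h : ℝ) (s : ℤ → ℤ), 47 / 50 ≤ a ∧ a ≤ 1 ∧ 39 / 50 * a ≤ h ∧ h ≤ 17 / 20 * a ∧ IsHaggSeq s ∧ (fun S : Set (EuclideanSpace ℝ (Fin 3)) => (∀ j : Fin N, dist (x j) (x i) ≤ 2 → ∃ p ∈ S, dist (x j) p ≤ 2 / 5) ∧ (∀ p ∈ S, dist p (x i) ≤ 2 → ∃ j : Fin N, dist (x j) p ≤ 2 / 5)) {p | ∃ m u v : ℤ, p = x i + A (((u : ℝ) • triangularVec₁ a) + ((v : ℝ) • triangularVec₂ a) + ((haggLabel s m : ℝ) • barlowOffset a) + ((m : ℝ) • layerNormal h))})) → (∑ i ∈ Ω, (sInf {e : ℝ | 0 ≤ e ∧ IsTwoShellGood e (47 / 50) 1 x i}) ^ 2) ≤ K * ((∑ i ∈ Ω, (1 / 2 : ℝ) * (∑ j ∈ Ω.erase i, lennardJones (dist (x i) (x j)))) - (Ω.card : ℝ) * (⨅ Q : PeriodicConfiguration 3, Q.energyPerParticle lennardJones)) + C * (Nat.card {i : Fin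 N // i ∈ Ω ∧ ∃ j : Fin N, j ∉ Ω ∧ dist (x j) (x i) ≤ 4} : ℝ)) :
    ∀ ε₁ : ℝ, 1 / 100 ≤ ε₁ → ε₁ ≤ 1 / 20 → ∃ K : ℝ, 0 ≤ K ∧ ∃ C : ℝ, ∀ (N : ℕ) (x : Fin N → EuclideanSpace ℝ (Fin 3)),
      (∀ i j : Fin N, i ≠ j → 1 / 3 ≤ dist (x i) (x j)) →
      (∀ (i : Fin N) (y : EuclideanSpace ℝ (Fin 3)), (∀ j : Fin N, j ≠ i → y ≠ x j) → siteEnergy lennardJones x i ≤ ∑ j ∈ Finset.univ.erase i, lennardJones (dist y (x j))) →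
      (∀ i : Fin N, ∑ j ∈ Finset.univ.erase i, (deriv lennardJones (dist (x i) (x j)) / dist (x i) (x j)) • (x i - x j) = 0) →
      ∀ Ω : Finset (Fin N), (∀ i ∈ Ω, IsTwoShellGood (1 / 20) (47 / 50) 1 x i) →
      (∀ i ∈ Ω, (∀ k : Fin N, dist (x k) (x i) ≤ 3 → k ∈ Ω) → (∃ (A : EuclideanSpace ℝ (Fin 3) →ₗᵢ[ℝ] EuclideanSpace ℝ (Fin 3)) (a h : ℝ) (s : ℤ → ℤ), 47 / 50 ≤ a ∧ a ≤ 1 ∧ 39 / 50 * a ≤ h ∧ h ≤ 17 / 20 * a ∧ IsHaggSeq s ∧ (fun S : Set (EuclideanSpace ℝ (Fin 3)) => (∀ j : Fin N, dist (x j) (x i) ≤ 2 → ∃ p ∈ S, dist (x j) p ≤ 2 / 5) ∧ (∀ p ∈ S, dist p (x i) ≤ 2 → ∃ j : Fin N, dist (x j) p ≤ 2 / 5)) {p | ∃ m u v : ℤ, p = x i + A (((u : ℝ) • triangularVec₁ a) + ((v : ℝ) • triangularVec₂ a) + ((haggLabel s m : ℝ) • barlowOffset a) + ((m : ℝ) •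 layerNormal h))})) → (Nat.card {i : Fin N // i ∈ Ω ∧ ¬ IsTwoShellGood ε₁ (47 / 50) 1 x i} : ℝ) ≤ K * ((∑ i ∈ Ω, (1 / 2 : ℝ) * (∑ j ∈ Ω.erase i, lennardJones (dist (x i) (x j)))) - (Ω.card : ℝ) * (⨅ Q : PeriodicConfiguration 3, Q.energyPerParticle lennardJones)) + C * (Nat.card {i : Fin N // i ∈ Ω ∧ ∃ j : Fin N, j ∉ Ω ∧ dist (x j) (x i) ≤ 4} : ℝ) := by
  -- adapted from `PhononSlackNearFieldConvexity.stub_roughOfDistortion` (twin crux 13958, worker W3)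
  intro ε₁ hε₁ _hε₁'
  obtain ⟨K, hK, C, hKC⟩ := hsq
  have hε0 : 0 < ε₁ := by linarith
  have hε2 : 0 < ε₁ ^ 2 := by positivity
  refine ⟨K / ε₁ ^ 2, div_nonneg hK hε2.le, C / ε₁ ^ 2, ?_⟩
  intro N x hsep hnash hfb Ω hΩ hchart
  have h := hKC N x hsep hnash hfb Ω hΩ hchart
  have hch := sq_mul_natCard_notGood_le x Ω (by norm_num : (0 : ℝ) ≤ 1 / 20) hε0.le hΩ
  have hmain := hch.trans h
  rw [div_mul_eq_mul_div, div_mul_eq_mul_div, ← add_div, le_div_iff₀ hε2]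
  linarith

/-! ### The first-order (virial) transfer

Why a certificate needs transfers at all, and what they look like to first order (worker audit): the calibrated
half-bond site excess `h_i = ½Σ_j V(r_ij) − e*` has a nonzero FIRST variation under displacements of the
neighbours of `i` alone (numerically the one-centre minimum over the `1/20` tube is `≈ −0.046`), although the total
energy of a force-balanced reference is stationary.  Writing `f i j` for the reference bond force (antisymmetric,
`Σ_j f i j = 0` at every site) and `u` for the displacement, the first variation of `h_i` is `½Σ_j ⟪f i j, u j − u i⟫
= ½Σ_j ⟪f i j, u j⟫`, and the ANTISYMMETRIC pair quantity `τ i j := −½⟪f i j, u i + u j⟫` has row sums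
`Σ_j τ i j = −½Σ_j ⟪f i j, u j⟫` (force balance kills the `u i` term): adding it cancels the first variation
exactly, leaving a quadratic form whose positivity on the tube is the tube-coercivity question.  The two identities: -/

/-- The virial transfer `τ i j = −½⟪f i j, u i + u j⟫` of an antisymmetric bond field `f` is antisymmetric.
[folklore] -/
theorem virialTransfer_antisymm {ι : Type*} (f : ι → ι → EuclideanSpace ℝ (Fin 3))
    (hf : ∀ i j, f i j = -f j i) (u : ι → EuclideanSpace ℝ (Fin 3)) (i j : ι) :
    -(1 / 2 : ℝ) * inner ℝ (f i j) (u i + u j) = -(-(1 / 2 : ℝ) * inner ℝ (f j i) (u j + u i)) := by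
  rw [hf i j, inner_neg_left, add_comm (u i) (u j)]
  ring

/-- Row sums of the virial transfer under force balance: if `Σ_{j∈Ω} f i j = 0` then
`Σ_{j∈Ω} (−½⟪f i j, u i + u j⟫) = −½ Σ_{j∈Ω} ⟪f i j, u j⟫` — exactly minus the first variation
`½Σ_j ⟪f i j, u j⟫` of the half-bond site energy. [folklore] -/
theorem sum_virialTransfer_eq {ι : Type*} (Ω : Finset ι) (f : ι → ι → EuclideanSpace ℝ (Fin 3))
    (u : ι → EuclideanSpace ℝ (Fin 3)) (i : ι) (hbal : ∑ j ∈ Ω, f i j = 0) :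
    ∑ j ∈ Ω, (-(1 / 2 : ℝ) * inner ℝ (f i j) (u i + u j)) = -(1 / 2 : ℝ) * ∑ j ∈ Ω, inner ℝ (f i j) (u j) := by
  have h1 : ∑ j ∈ Ω, inner ℝ (f i j) (u i) = 0 := by
    rw [← sum_inner, hbal, inner_zero_left]
  simp_rw [inner_add_right]
  rw [← Finset.mul_sum, Finset.sum_add_distrib, h1, zero_add]

end Summit.AtomisticToContinuum.Crystallization.Theorems.NashClassCertificatesNashNearField
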